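import Summits.ValiantsHypothesis.ValiantsHypothesis.Theorems.BarrierLeverAnchoredDoorHitsLowerPairsStarTwoCentre
import Mathlib.LinearAlgebra.Matrix.Rank

/-!
# Route BarrierLever — support item `AnchoredDoorHitsLowerPairs` (stmt-ValiantsHypothesis-22510), line `anchored_peeling`:
# REFUTATION OF THE NODE `Stmt.conjStarTwoCentre` (the two-centre CERTIFICATE has a rank obstruction on very deep pairs)

Helper file (`--supports stmt-ValiantsHypothesis-22510`; val-np-p1 g34, correcting its own node of p752239). Closes NO item; it refutes a
CERTIFICATE conjecture, NOT `Stmt.conjStarLower` / `Stmt.conjStarLowerFaceRich` (the counterexample pair below is trivially star-good).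
Nothing here bears on crux 14610 or on `VP ≠ VNP`, which is NOT proved.

**THEOREM (`not_conjStarTwoCentre`): `¬ Stmt.conjStarTwoCentre`.** The two-centre entry is, by definition, the sum over (row centres `A'`,
column centres `S'`) with `|A'| + |S'| = bigInd A + bigInd S ≤ 2` of `Φ(A; A', S') · Ψ(S; A', S')`; hence the two-centre matrix FACTORS
through the index type `(Fin 2 × Fin 2) × {A' : |A'| ≤ 2} × {S' : |S'| ≤ 2}` (`twoTop_eq_sum_idx`), whose size is `4 N²`, `N = 1 + h + C(h,2)`.
For `u = w =` all subsets of `Fin 20` (`r = 2^20 > 4 · 211²`) the rank of the two-centre matrix is `< r` for EVERY choice of weights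
(`Matrix.rank_mul_le_left`, `Matrix.rank_le_card_width`), so its determinant vanishes, while the pair is face-rich (`20 + 20 + 1 < 2^20`).
Census of record (unchanged): the two-centre matrix IS nonsingular on every balanced/face-rich pair on `≤ 5+5` vertices and on all random
pairs below the rank bound (kit j336933); the design theorems (…StarTwoCentreDesignDet, …StarExcessOne) are unaffected.
-/

set_option linter.dupNamespace false

namespace Summit.ValiantsHypothesis.ValiantsHypothesis.Theorems.BarrierLever.AnchoredPeeling

open Finset

noncomputable section

namespace StarDoor

variable {K : Type*} [CommRing K] {h : ℕ}

/-! ## 1. The factorisation of the two-centre entry through small centre sets -/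

/-- Centre sets of size `≤ 2`. -/
abbrev Small (h : ℕ) := {A : Finset (Fin h) // A.card ≤ 2}

/-- The factorisation index: (row class, column class, row centres, column centres). -/
abbrev RIdx (h : ℕ) := (Fin 2 × Fin 2) × (Small h × Small h)

/-- Left factor: the row side of a two-centre summand. -/
def Lf (gb : Fin h → Fin h → K) (A : Finset (Fin h)) (ι : RIdx h) : K :=
  (if bigInd A = ι.1.1.val ∧ ι.2.1.1.card + ι.2.2.1.card = ι.1.1.val + ι.1.2.val ∧ ι.2.1.1 ⊆ A then 1 else 0) *
    ∏ b ∈ A \ ι.2.1.1, ∑ e ∈ ι.2.2.1, gb b e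

/-- Right factor: the column side of a two-centre summand. -/
def Mf (db : Fin h → Fin h → K) (ι : RIdx h) (S : Finset (Fin h)) : K :=
  (if bigInd S = ι.1.2.val ∧ ι.2.2.1 ⊆ S then 1 else 0) * ∏ e ∈ S \ ι.2.2.1, ∑ b ∈ ι.2.1.1, db b e

/-- The canonical middle form. -/
def midTerm (gb db : Fin h → Fin h → K) (A S : Finset (Fin h)) (x y : Small h) : K :=
  if x.1 ⊆ A ∧ y.1 ⊆ S ∧ x.1.card + y.1.card = bigInd A + bigInd S then scCoef gb db A S x.1 y.1 else 0

variable (gb db : Fin h → Fin h → K)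

/-- A powerset sum whose summand vanishes off small sets is a sum over `Small h` with a containment indicator. -/
theorem sum_powerset_eq_sum_small (A : Finset (Fin h)) (G : Finset (Fin h) → K) (hG : ∀ A' ∈ A.powerset, G A' ≠ 0 → A'.card ≤ 2) :
    ∑ A' ∈ A.powerset, G A' = ∑ x : Small h, (if x.1 ⊆ A then G x.1 else 0) := by
  classical
  rw [← Finset.sum_filter_of_ne hG]
  have hs : ∑ x : Small h, (if x.1 ⊆ A then G x.1 else 0) =
      ∑ A' ∈ (univ : Finset (Finset (Fin h))).filter (fun A' => A'.card ≤ 2), (if A' ⊆ A then G A' else 0) := by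
    rw [← Finset.sum_subtype ((univ : Finset (Finset (Fin h))).filter (fun A' => A'.card ≤ 2)) (by simp)
      (fun A' => if A' ⊆ A then G A' else 0)]
  rw [hs, ← Finset.sum_filter]
  refine Finset.sum_congr ?_ fun _ _ => rfl
  ext A'; simp [Finset.mem_powerset, and_comm]

/-- **The two-centre entry in middle form.** -/
theorem twoTop_eq_mid (A S : Finset (Fin h)) : twoTop gb db A S = ∑ x : Small h, ∑ y : Small h, midTerm gb db A S x y := by
  classical
  have hbA := bigInd_le_one A
  have hbS := bigInd_le_one S
  have hbA' := bigInd_le_card A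
  have hbS' := bigInd_le_card S
  unfold twoTop
  -- rewrite the degree condition as a condition on the numbers of centres
  have h1 : ∀ A' ∈ A.powerset, ∀ S' ∈ S.powerset,
      (scDeg A S A' S' = tcPot A S ↔ A'.card + S'.card = bigInd A + bigInd S) := by
    intro A' hA' S' hS'
    have hA'A := Finset.mem_powerset.mp hA'
    have hS'S := Finset.mem_powerset.mp hS'
    unfold scDeg tcPot
    rw [Finset.card_sdiff_of_subset hA'A, Finset.card_sdiff_of_subset hS'S]
    have := Finset.card_le_card hA'A; have := Finset.card_le_card hS'S
    omega
  rw [Finset.sum_congr rfl fun A' hA' => Finset.sum_congr rfl fun S' hS' =>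
    show (if scDeg A S A' S' = tcPot A S then scCoef gb db A S A' S' else 0) =
      (if A'.card + S'.card = bigInd A + bigInd S then scCoef gb db A S A' S' else 0) by
      by_cases hc : A'.card + S'.card = bigInd A + bigInd S
      · rw [if_pos hc, if_pos ((h1 A' hA' S' hS').mpr hc)]
      · rw [if_neg hc, if_neg (fun h' => hc ((h1 A' hA' S' hS').mp h'))]]
  -- outer sum over small row-centre sets
  rw [sum_powerset_eq_sum_small A _ (fun A' _ hne => by
    by_contra hgt
    apply hne
    exact Finset.sum_eq_zero fun S' _ => by rw [if_neg]; omega)]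
  refine Finset.sum_congr rfl fun x _ => ?_
  by_cases hxA : x.1 ⊆ A
  · rw [if_pos hxA]
    -- inner sum over small column-centre sets
    rw [sum_powerset_eq_sum_small S _ (fun S' _ hne => by
      by_contra hgt
      apply hne
      rw [if_neg]; omega)]
    refine Finset.sum_congr rfl fun y _ => ?_
    unfold midTerm
    by_cases hyS : y.1 ⊆ S
    · rw [if_pos hyS]
      by_cases hc : x.1.card + y.1.card = bigInd A + bigInd S
      · rw [if_pos hc, if_pos ⟨hxA, hyS, hc⟩]
      · rw [if_neg hc, if_neg (fun h' => hc h'.2.2)]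
    · rw [if_neg hyS, if_neg (fun h' => hyS h'.2.1)]
  · rw [if_neg hxA]
    symm
    exact Finset.sum_eq_zero fun y _ => by unfold midTerm; rw [if_neg (fun h' => hxA h'.1)]

/-- **The factorised form equals the middle form.** -/
theorem sum_idx_eq_mid (A S : Finset (Fin h)) :
    ∑ ι : RIdx h, Lf gb A ι * Mf db ι S = ∑ x : Small h, ∑ y : Small h, midTerm gb db A S x y := by
  classical
  have hbA := bigInd_le_one A
  have hbS := bigInd_le_one S
  rw [Fintype.sum_prod_type, Finset.sum_comm, Fintype.sum_prod_type]
  refine Finset.sum_congr rfl fun x _ => Finset.sum_congr rfl fun y _ => ?_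
  -- collapse the sum over the classes `(a, s)` to `a = bigInd A`, `s = bigInd S`
  rw [Fintype.sum_prod_type]
  rw [Finset.sum_eq_single (⟨bigInd A, by omega⟩ : Fin 2)]
  · rw [Finset.sum_eq_single (⟨bigInd S, by omega⟩ : Fin 2)]
    · unfold Lf Mf midTerm scCoef
      simp only [true_and]
      by_cases h1 : x.1.card + y.1.card = bigInd A + bigInd S ∧ x.1 ⊆ A
      · by_cases h2 : y.1 ⊆ S
        · rw [if_pos h1, if_pos h2, if_pos ⟨h1.2, h2, h1.1⟩]; ring
        · rw [if_pos h1, if_neg h2, if_neg (fun h' => h2 h'.2.1)]; ring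
      · rw [if_neg h1, if_neg (show ¬(x.1 ⊆ A ∧ y.1 ⊆ S ∧ x.1.card + y.1.card = bigInd A + bigInd S) from
            fun h' => h1 ⟨h'.2.2, h'.1⟩)]
        ring
    · intro s _ hs
      unfold Mf
      rw [if_neg (fun h' => hs (Fin.ext h'.1.symm)), zero_mul, mul_zero]
    · intro h'; exact absurd (Finset.mem_univ _) h'
  · intro a _ ha
    refine Finset.sum_eq_zero fun s _ => ?_
    unfold Lf
    rw [if_neg (fun h' => ha (Fin.ext h'.1.symm)), zero_mul, zero_mul]
  · intro h'; exact absurd (Finset.mem_univ _) h'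

/-- **THE FACTORISATION:** `twoTop = Σ_ι Lf · Mf`. -/
theorem twoTop_eq_sum_idx (A S : Finset (Fin h)) : twoTop gb db A S = ∑ ι : RIdx h, Lf gb A ι * Mf db ι S := by
  rw [twoTop_eq_mid, sum_idx_eq_mid]

/-! ## 2. The rank bound and the counterexample -/

/-- **Rank bound:** the two-centre matrix of any families has rank `≤ |RIdx h|`. -/
theorem rank_twoTop_le {r : ℕ} (u w : Fin r → Finset (Fin h)) (gb db : Fin h → Fin h → ℂ) :
    (Matrix.of fun i j : Fin r => twoTop gb db (u i) (w j)).rank ≤ Fintype.card (RIdx h) := by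
  classical
  let L : Matrix (Fin r) (RIdx h) ℂ := Matrix.of fun i ι => Lf gb (u i) ι
  let M : Matrix (RIdx h) (Fin r) ℂ := Matrix.of fun ι j => Mf db ι (w j)
  have hLM : (Matrix.of fun i j : Fin r => twoTop gb db (u i) (w j)) = L * M := by
    ext i j
    rw [Matrix.of_apply, twoTop_eq_sum_idx, Matrix.mul_apply]
    rfl
  rw [hLM]
  exact (Matrix.rank_mul_le_left L M).trans (Matrix.rank_le_card_width L)

/-- The number of centre sets of size `≤ 2` on `Fin 20` is at most `211`. -/
theorem card_small_le : Fintype.card (Small 20) ≤ 211 := by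
  classical
  rw [Fintype.card_subtype]
  have hsub : (univ : Finset (Finset (Fin 20))).filter (fun A => A.card ≤ 2) ⊆
      (univ.powersetCard 0 ∪ univ.powersetCard 1) ∪ univ.powersetCard 2 := by
    intro A hA
    have hc := (Finset.mem_filter.mp hA).2
    simp only [Finset.mem_union, Finset.mem_powersetCard, Finset.subset_univ, true_and]
    omega
  refine (Finset.card_le_card hsub).trans ?_
  refine (Finset.card_union_le _ _).trans ?_
  refine (Nat.add_le_add_right (Finset.card_union_le _ _) _).trans ?_
  simp only [Finset.card_powersetCard, Finset.card_univ, Fintype.card_fin]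
  decide

/-- **`Stmt.conjStarTwoCentre` is false** (counterexample: all subsets of `Fin 20` on both sides). -/
theorem not_conjStarTwoCentre : ¬ Stmt.conjStarTwoCentre := by
  classical
  intro H
  let r : ℕ := Fintype.card (Finset (Fin 20))
  have hr : r = 2 ^ 20 := by simp [r, Fintype.card_finset]
  let u : Fin r → Finset (Fin 20) := fun i => (Fintype.equivFin (Finset (Fin 20))).symm i
  have hu : Function.Injective u := (Fintype.equivFin (Finset (Fin 20))).symm.injective
  have hsurj : Function.Surjective u := (Fintype.equivFin (Finset (Fin 20))).symm.surjective
  have hlu : IsLowerSet (Set.range u) := by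
    rw [Set.range_eq_univ.mpr hsurj]; exact isLowerSet_univ
  -- the number of faces of size one is 20
  have hn : (univ.filter fun i : Fin r => (u i).card = 1).card ≤ 20 := by
    have himg : (univ.filter fun i : Fin r => (u i).card = 1).card =
        ((univ.filter fun i : Fin r => (u i).card = 1).image u).card :=
      (Finset.card_image_of_injective _ hu).symm
    rw [himg]
    have hsub : (univ.filter fun i : Fin r => (u i).card = 1).image u ⊆ univ.powersetCard 1 := by
      intro A hA
      obtain ⟨i, hi, rfl⟩ := Finset.mem_image.mp hA
      exact Finset.mem_powersetCard.mpr ⟨Finset.subset_univ _, (Finset.mem_filter.mp hi).2⟩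
    refine (Finset.card_le_card hsub).trans ?_
    rw [Finset.card_powersetCard, Finset.card_univ, Fintype.card_fin, Nat.choose_one_right]
  have h41 : 41 < r := by rw [hr]; norm_num
  have hface : (univ.filter fun i : Fin r => (u i).card = 1).card + (univ.filter fun j : Fin r => (u j).card = 1).card + 1 < r := by
    omega
  obtain ⟨gb, db, hdet⟩ := H 20 r u u hu hu hlu hlu hface
  -- rank of a nonsingular matrix is `r`, but the rank is at most `4 · 211²`
  set T : Matrix (Fin r) (Fin r) ℂ := Matrix.of fun i j : Fin r => twoTop gb db (u i) (u j) with hT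
  have hunit : IsUnit T := (Matrix.isUnit_iff_isUnit_det T).mpr (Ne.isUnit hdet)
  have hrank : T.rank = r := by rw [Matrix.rank_of_isUnit T hunit, Fintype.card_fin]
  have hle : T.rank ≤ Fintype.card (RIdx 20) := rank_twoTop_le u u gb db
  have hcard : Fintype.card (RIdx 20) ≤ 4 * (211 * 211) := by
    simp only [RIdx, Fintype.card_prod, Fintype.card_fin]
    have := card_small_le
    calc 2 * 2 * (Fintype.card (Small 20) * Fintype.card (Small 20)) ≤ 2 * 2 * (211 * 211) := by
          apply Nat.mul_le_mul_left; exact Nat.mul_le_mul this this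
      _ = 4 * (211 * 211) := by norm_num
  rw [hrank, hr] at hle
  omega

end StarDoor

end

end Summit.ValiantsHypothesis.ValiantsHypothesis.Theorems.BarrierLever.AnchoredPeeling
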